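import Summits.Ventures.QEC.CircuitDistance.PortXTable
import Summits.Ventures.QEC.CircuitDistance.PortFibreLeaf
import HarnessLib

/-!
# P3-PORT addendum: DETECTOR RELABELLING of fibre leaves (cell `qec`, experiment CDX; drafted by qec-cdx-idea-2, typed by
# qec-cdx-type-2, statement audit qec-cdx-crit-1; OPTIONAL β of director-qec R160 (2) — the «leaf transport»; generic, nothing here
# mentions a circuit order or asserts a value of `d_circ`)

A fibre leaf (`Fibre.Leaf`) never looks at detector VALUES, only at which coordinates share a detector.  Hence relabelling
every encoded detector by a map `φ` that is injective on the leaf's detectors cannot create a realisation: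

* `Fibre.Leaf.relabel L φ` — the leaf with `coords[c] ↦ coords[c].map φ` (coordinates, groups, nulls, CNF data, `w`
  untouched; `k`, `group`, `nulls`, `budget` are definitionally those of `L`);
* `Fibre.Leaf.injOnB L φ` — DECIDABLE: `φ` is injective on the detectors of `L`;
* **`Fibre.Leaf.realised_of_relabel`** / **`Fibre.Leaf.not_realised_relabel`**: `injOnB L φ = true → ¬ L.Realised →
  ¬ (L.relabel φ).Realised`.

Use (Q4 lane, `Z` sector of a self-dual order such as `sched345`): the `Z` leaf entry dual to an `X` leaf entry `e` is
`⟨e.word.map dualQ, e.leaf.relabel φ⟩` with `φ = phiDet N₀` below (layer `s ↦ N₀ − s`, check `j ↦ −j`, re-encoded by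
`encDet`); its cheap side conditions (`wf`, `ZTable.covers₀ … = true`, `Nodup`, `w`, `budget`) stay `decide`, and the
expensive one, `¬ Realised`, is `not_realised_relabel` applied to the LANDED `X` leaf's `¬ Realised` — no second UNSAT /
cube replay.  If `Φ` were not a symmetry of the DEM in the window, `covers₀` would simply fail to `decide`; nothing false can
land.
-/

namespace Summit.Ventures.QEC.CircuitDistance

open Literature.InformationTheory.QuantumCodes

namespace Fibre

/-! ## Relabelling a leaf -/

/-- Relabel every encoded detector of a leaf by `φ` (all other data untouched). -/
def Leaf.relabel (L : Leaf) (φ : ℕ → ℕ) : Leaf := { L with coords := L.coords.map (List.map φ) }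

/-- Relabelling keeps the number of groups. -/
@[simp] theorem Leaf.relabel_k (L : Leaf) (φ : ℕ → ℕ) : (L.relabel φ).k = L.k := rfl
/-- Relabelling keeps each coordinate group. -/
@[simp] theorem Leaf.relabel_group (L : Leaf) (φ : ℕ → ℕ) (j : ℕ) : (L.relabel φ).group j = L.group j := rfl
/-- Relabelling keeps the null coordinates. -/
@[simp] theorem Leaf.relabel_nulls (L : Leaf) (φ : ℕ → ℕ) : (L.relabel φ).nulls = L.nulls := rfl
/-- Relabelling keeps the budget. -/
@[simp] theorem Leaf.relabel_budget (L : Leaf) (φ : ℕ → ℕ) : (L.relabel φ).budget = L.budget := rfl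
/-- Relabelling keeps the weight. -/
@[simp] theorem Leaf.relabel_w (L : Leaf) (φ : ℕ → ℕ) : (L.relabel φ).w = L.w := rfl
/-- Relabelling keeps the group data. -/
@[simp] theorem Leaf.relabel_groups (L : Leaf) (φ : ℕ → ℕ) : (L.relabel φ).groups = L.groups := rfl
/-- The coordinates of the relabelled leaf. -/
@[simp] theorem Leaf.relabel_coords (L : Leaf) (φ : ℕ → ℕ) : (L.relabel φ).coords = L.coords.map (List.map φ) := rfl

/-- The detector rows of a coordinate of the relabelled leaf. -/
theorem Leaf.coordsOf_relabel (L : Leaf) (φ : ℕ → ℕ) (c : ℕ) : (L.relabel φ).coordsOf c = (L.coordsOf c).map φ := by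
  unfold Leaf.coordsOf
  rw [Leaf.relabel_coords, List.getD_eq_getElem?_getD, List.getD_eq_getElem?_getD, List.getElem?_map]
  cases L.coords[c]? <;> rfl

/-- Every detector row entry is one of the leaf's detector entries. -/
theorem Leaf.mem_flatten_of_mem_coordsOf (L : Leaf) {c d : ℕ} (h : d ∈ L.coordsOf c) : d ∈ L.coords.flatten := by
  unfold Leaf.coordsOf at h
  rw [List.getD_eq_getElem?_getD] at h
  rcases hc : L.coords[c]? with _ | l
  · rw [hc] at h; simp at h
  · rw [hc, Option.getD_some] at h
    exact List.mem_flatten.2 ⟨l, List.mem_of_getElem? hc, h⟩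

/-- DECIDABLE: `φ` is injective on the detectors of `L`. -/
def Leaf.injOnB (L : Leaf) (φ : ℕ → ℕ) : Bool := decide ((L.coords.flatten.dedup.map φ).Nodup)

/-- What `injOnB` says. -/
theorem Leaf.injOn_of_injOnB {L : Leaf} {φ : ℕ → ℕ} (h : L.injOnB φ = true) {x y : ℕ} (hx : x ∈ L.coords.flatten)
    (hy : y ∈ L.coords.flatten) (hxy : φ x = φ y) : x = y := by
  unfold Leaf.injOnB at h
  have hnd := of_decide_eq_true h
  exact (List.nodup_map_iff_inj_on (List.nodup_dedup _)).1 hnd x (List.mem_dedup.2 hx) y (List.mem_dedup.2 hy) hxy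

/-- Under an injective relabelling, «`φ d` lies in the relabelled row» is «`d` lies in the row» (for a detector `d` of `L`). -/
theorem Leaf.mem_coordsOf_relabel_iff {L : Leaf} {φ : ℕ → ℕ} (h : L.injOnB φ = true) {d : ℕ} (hd : d ∈ L.coords.flatten)
    (c : ℕ) : φ d ∈ (L.relabel φ).coordsOf c ↔ d ∈ L.coordsOf c := by
  rw [Leaf.coordsOf_relabel, List.mem_map]
  constructor
  · rintro ⟨x, hx, hxd⟩
    rwa [← Leaf.injOn_of_injOnB h (L.mem_flatten_of_mem_coordsOf hx) hd hxd]
  · exact fun hm => ⟨d, hm, rfl⟩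

/-- **A realisation of the relabelled leaf is a realisation of the leaf** (injective relabelling). -/
theorem Leaf.realised_of_relabel (L : Leaf) (φ : ℕ → ℕ) (hφ : L.injOnB φ = true) (h : (L.relabel φ).Realised) :
    L.Realised := by
  obtain ⟨pick, N, hpick, hN, hcard, hpar⟩ := h
  refine ⟨pick, N, hpick, hN, hcard, fun d => ?_⟩
  by_cases hd : d ∈ L.coords.flatten
  · have h1 := hpar (φ d)
    have e1 : (Finset.univ.filter fun j : Fin (L.relabel φ).k => φ d ∈ (L.relabel φ).coordsOf (pick j)) =
        (Finset.univ.filter fun j : Fin L.k => d ∈ L.coordsOf (pick j)) :=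
      Finset.filter_congr fun j _ => L.mem_coordsOf_relabel_iff hφ hd (pick j)
    have e2 : (N.filter fun c => φ d ∈ (L.relabel φ).coordsOf c) = (N.filter fun c => d ∈ L.coordsOf c) :=
      Finset.filter_congr fun c _ => L.mem_coordsOf_relabel_iff hφ hd c
    rw [e1, e2] at h1
    exact h1
  · have z1 : (Finset.univ.filter fun j : Fin L.k => d ∈ L.coordsOf (pick j)) = ∅ :=
      Finset.filter_eq_empty_iff.2 fun j _ hm => hd (L.mem_flatten_of_mem_coordsOf hm)
    have z2 : (N.filter fun c => d ∈ L.coordsOf c) = ∅ :=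
      Finset.filter_eq_empty_iff.2 fun c _ hm => hd (L.mem_flatten_of_mem_coordsOf hm)
    rw [z1, z2]
    simp

/-- **No realisation survives an injective relabelling.** -/
theorem Leaf.not_realised_relabel (L : Leaf) (φ : ℕ → ℕ) (hφ : L.injOnB φ = true) (h : ¬ L.Realised) :
    ¬ (L.relabel φ).Realised :=
  fun hr => h (L.realised_of_relabel φ hφ hr)

end Fibre

/-! ## The time-reversal / check-inversion relabelling of encoded detectors -/

variable {ℓ m : ℕ} [NeZero ℓ] [NeZero m]

omit [NeZero ℓ] [NeZero m] in
/-- `ℓ·m` is positive. -/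
theorem lm_pos [NeZero ℓ] [NeZero m] : 0 < ℓ * m := Nat.mul_pos (Nat.pos_of_ne_zero (NeZero.ne ℓ)) (Nat.pos_of_ne_zero (NeZero.ne m))

/-- `Φ` on ENCODED detectors of the `N₀`-window: `encDet (s, j) ↦ encDet (N₀ − s, −j)` (layer reversal, check inversion). -/
def phiDet (ℓ m : ℕ) [NeZero ℓ] [NeZero m] (N₀ : ℕ) (d : ℕ) : ℕ :=
  encDet ((N₀ - d / (ℓ * m)), -((BB.Code.checkIndex (ℓ := ℓ) (m := m)).symm ⟨d % (ℓ * m), Nat.mod_lt _ lm_pos⟩))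

/-- `Φ` on a detector of the window, in coordinates. -/
theorem phiDet_encDet (N₀ s : ℕ) (j : BB.Mono ℓ m) :
    phiDet ℓ m N₀ (encDet (s, j)) = encDet (N₀ - s, -j) := by
  unfold phiDet encDet
  have hj := (BB.Code.checkIndex j).2
  have h1 : (s * (ℓ * m) + (BB.Code.checkIndex j : ℕ)) / (ℓ * m) = s := by
    rw [Nat.add_comm, Nat.add_mul_div_right _ _ lm_pos, Nat.div_eq_of_lt hj, Nat.zero_add]
  have h2 : (s * (ℓ * m) + (BB.Code.checkIndex j : ℕ)) % (ℓ * m) = BB.Code.checkIndex j := by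
    rw [Nat.add_comm, Nat.add_mul_mod_self_right, Nat.mod_eq_of_lt hj]
  have h3 : ∀ (h : (s * (ℓ * m) + ↑(BB.Code.checkIndex j)) % (ℓ * m) < ℓ * m),
      (BB.Code.checkIndex (ℓ := ℓ) (m := m)).symm ⟨_, h⟩ = j := fun h => by
    rw [Equiv.symm_apply_eq]; exact Fin.ext h2
  simp only [h1, h3]

/-- Sanity (the `[[144]]` window `N₀ = 10`): `Φ` swaps the detector `(0, (1,2))` with `(10, (11,4))` and is an involution there. -/
example : phiDet 12 6 10 (encDet (0, ((1 : Fin 12), (2 : Fin 6)))) = encDet (10, ((11 : Fin 12), (4 : Fin 6))) := by decide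
example : phiDet 12 6 10 (phiDet 12 6 10 (encDet (3, ((1 : Fin 12), (2 : Fin 6))))) = encDet (3, ((1 : Fin 12), (2 : Fin 6))) := by
  decide

end Summit.Ventures.QEC.CircuitDistance
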